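import Literature.RingTheory.Flat.TorBaseChange
import Mathlib.RingTheory.Flat.Localization
import Mathlib.RingTheory.Flat.Stability
import Mathlib.RingTheory.Localization.BaseChange
import Mathlib.RingTheory.Localization.AtPrime.Basic
import Mathlib.RingTheory.Localization.FractionRing
import Mathlib.RingTheory.Localization.LocalizationLocalization
import Mathlib.RingTheory.TensorProduct.Quotient
import Mathlib.RingTheory.IsTensorProduct
import Mathlib.RingTheory.Ideal.Over
import Mathlib.Algebra.Module.Torsion.Basic
import Mathlib.LinearAlgebra.TensorProduct.Tower
import HarnessLib

/-!
# Lemmas for the fibrewise criterion of flatness (Stacks 00MP, 00R7, 05UV)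

Generic commutative algebra used by `Literature/RingTheory/Flat/FibrewiseCriterionProofs.lean`
(the proof of the named fact `Stacks05UV`, The Stacks Project, Tags 00MP/00R7/05UV):

* `exists_lid_of_surjective`, `flat_of_flat_of_surjective`, `flat_baseChange_of_surjective`,
  `compatibleSMul_of_surjective` — tensor products over a quotient ring: for `R → S` surjective and
  an `S`-module `N`, `S ⊗_R N ≃ N`, so an `S`-module which is flat over `R` is flat over `S`;
* `injective_lTensor_subtype_map_of_flat` — the `Tor₁` trick in the proof of Tag 00MP: if `M` is an
  `R′`-module which is flat over `R`, then `M ⊗_{R′} IR′ → M` is injective for every ideal `I ⊆ R`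
  (`M ⊗_R I → M ⊗_{R′} IR′` is onto and `M ⊗_R I → M` is injective);
* `exists_smul_eq_zero_of_tmul_one_eq_zero` — for a prime `𝔭 ⊆ T`, a field `k` under `T` with
  `Ker(T → k) = 𝔭` and a `T`-module `V` killed by `𝔭`, the kernel of `V → V ⊗_T k` is
  `(T ∖ 𝔭)`-torsion (`k ⊇ Frac(T/𝔭)` is faithfully flat over `Frac(T/𝔭)`);
* `isPushout_quotient_map` — `B/IB = B ⊗_A A/I` as an `Algebra.IsPushout` square;
* `flat_localization_of_isPushout` — going up: for a pushout square `C₀ → C`, `P → B′ = C ⊗_{C₀} P`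
  and primes `Q = 𝔮 ∩ P`, if `P_Q` is flat over `C₀` then `B′_𝔮` is flat over `C`.

## References

* The Stacks Project, Tags 00MP, 00R7, 05UV. [StacksProject]
-/

universe u v w

open TensorProduct

namespace Literature.RingTheory.Flat

/-! ### Tensor products over a quotient ring -/

section Surjective

variable {R : Type*} {S : Type*} [CommRing R] [CommRing S] [Algebra R S]
  (hS : Function.Surjective (algebraMap R S))

include hS in
/-- For `R → S` surjective and `S`-modules `M`, `N`, scalars of `S` move across `⊗_R`.
[folklore] -/
theorem compatibleSMul_of_surjective (M N : Type*) [AddCommGroup M] [Module R M] [Module S M]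
    [IsScalarTower R S M] [AddCommGroup N] [Module R N] [Module S N] [IsScalarTower R S N] :
    TensorProduct.CompatibleSMul R S M N :=
  ⟨fun s m n => by
    obtain ⟨r, rfl⟩ := hS s
    rw [algebraMap_smul, algebraMap_smul, TensorProduct.smul_tmul]⟩

include hS in
/-- For `R → S` surjective and an `S`-module `N`, every element of `S ⊗_R N` is `1 ⊗ n`.
[folklore] -/
theorem exists_eq_one_tmul_of_surjective (N : Type*) [AddCommGroup N] [Module R N] [Module S N]
    [IsScalarTower R S N] (x : S ⊗[R] N) : ∃ n : N, x = (1 : S) ⊗ₜ[R] n := by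
  induction x using TensorProduct.induction_on with
  | zero => exact ⟨0, (TensorProduct.tmul_zero (N := N) (1 : S)).symm⟩
  | tmul s n =>
    obtain ⟨r, rfl⟩ := hS s
    exact ⟨r • n, by rw [Algebra.algebraMap_eq_smul_one, TensorProduct.smul_tmul]⟩
  | add x y hx hy =>
    obtain ⟨n, rfl⟩ := hx
    obtain ⟨n', rfl⟩ := hy
    exact ⟨n + n', (TensorProduct.tmul_add _ _ _).symm⟩

include hS in
/-- **`S ⊗_R N ≃ N`** (`S`-linearly, `s ⊗ n ↦ s n`) for an `S`-module `N` when `R → S` is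
surjective. [folklore] -/
theorem exists_lid_of_surjective (N : Type*) [AddCommGroup N] [Module R N] [Module S N]
    [IsScalarTower R S N] : ∃ e : S ⊗[R] N ≃ₗ[S] N, ∀ (s : S) (n : N), e (s ⊗ₜ[R] n) = s • n := by
  refine ⟨LinearEquiv.ofBijective ((LinearMap.id : N →ₗ[R] N).liftBaseChange S)
    ⟨fun x y hxy => ?_, fun n => ⟨1 ⊗ₜ n, by simp [LinearMap.liftBaseChange_tmul]⟩⟩,
    fun s n => LinearMap.liftBaseChange_tmul _ _ _ _⟩
  obtain ⟨n, rfl⟩ := exists_eq_one_tmul_of_surjective hS N x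
  obtain ⟨n', rfl⟩ := exists_eq_one_tmul_of_surjective hS N y
  simp only [LinearMap.liftBaseChange_tmul, LinearMap.id_coe, id_eq, one_smul] at hxy
  rw [hxy]

include hS in
/-- **An `S`-module which is flat over `R` is flat over `S`** when `R → S` is surjective
(`N ≃ S ⊗_R N`). [folklore] -/
theorem flat_of_flat_of_surjective (N : Type*) [AddCommGroup N] [Module R N] [Module S N]
    [IsScalarTower R S N] [Module.Flat R N] : Module.Flat S N := by
  obtain ⟨e, -⟩ := exists_lid_of_surjective hS N
  exact Module.Flat.of_linearEquiv e.symm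

include hS in
/-- For `R → S` surjective and a flat `S`-module `N`, `S ⊗_R N ≃ N` is flat over `S`.
[folklore] -/
theorem flat_baseChange_of_surjective (N : Type*) [AddCommGroup N] [Module R N] [Module S N]
    [IsScalarTower R S N] [Module.Flat S N] : Module.Flat S (S ⊗[R] N) := by
  obtain ⟨e, -⟩ := exists_lid_of_surjective hS N
  exact Module.Flat.of_linearEquiv e

end Surjective

/-! ### The `Tor₁` surjection trick of Tag 00MP -/

section TorTrick

variable {R : Type u} [CommRing R] {R' : Type v} [CommRing R'] [Algebra R R'] (I : Ideal R)
  (M : Type w) [AddCommGroup M] [Module R M] [Module R' M] [IsScalarTower R R' M]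

/-- **The `Tor₁` trick of Tag 00MP**: if the `R′`-module `M` is flat over `R`, then
`M ⊗_{R′} IR′ → M ⊗_{R′} R′` is injective (`Tor₁^{R′}(R′/IR′, M) = 0`) for every ideal `I ⊆ R`:
"Since `𝔪 ⊗_R S′ → I ⊗_S S′` is surjective … also `𝔪 ⊗_R M → I ⊗_S M` is surjective. As `M` is
flat over `R` the composition `𝔪 ⊗_R M → I ⊗_S M → M` is injective and so both arrows are
injective." Here the comparison map `M ⊗_R I → M ⊗_{R′} IR′` is `m ⊗ i ↦ m ⊗ i`
(`M ⊗_R I ≅ M ⊗_{R′} (R′ ⊗_R I) ↠ M ⊗_{R′} IR′`). [cite: StacksProject, Tag 00MP (proof)] -/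
theorem injective_lTensor_subtype_map_of_flat [Module.Flat R M] :
    Function.Injective (LinearMap.lTensor M (I.map (algebraMap R R')).subtype) := by
  -- the comparison map `τ : M ⊗_R I → M ⊗_{R′} IR′`
  let τ : M ⊗[R] ↥I →ₗ[R] M ⊗[R'] ↥(I.map (algebraMap R R')) :=
    ((LinearMap.lTensor M (mulMapIdeal I)).restrictScalars R) ∘ₗ
      ((TensorProduct.AlgebraTensorModule.cancelBaseChange R R' R' M ↥I).symm.toLinearMap.restrictScalars R)
  have hτ_tmul : ∀ (m : M) (i : ↥I), τ (m ⊗ₜ[R] i) = m ⊗ₜ[R'] mulMapIdeal I ((1 : R') ⊗ₜ[R] i) :=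
    fun m i => by
      simp [τ, TensorProduct.AlgebraTensorModule.cancelBaseChange_symm_tmul]
  have hτ : Function.Surjective τ := by
    change Function.Surjective (⇑(LinearMap.lTensor M (mulMapIdeal I)) ∘
      ⇑(TensorProduct.AlgebraTensorModule.cancelBaseChange R R' R' M ↥I).symm)
    exact (LinearMap.lTensor_surjective _ (mulMapIdeal_surjective I)).comp
      (LinearEquiv.surjective _)
  -- compatibility with the multiplication maps to `M`
  have hcomp : ∀ x, smulMap (I.map (algebraMap R R')) M (τ x) = smulMap I M x := by
    intro x
    induction x using TensorProduct.induction_on with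
    | zero => simp
    | add x y hx hy => rw [map_add, map_add, hx, hy, map_add]
    | tmul m i =>
      rw [hτ_tmul, smulMap_tmul, smulMap_tmul, mulMapIdeal_tmul_coe, smul_assoc, one_smul]
  rw [← LinearMap.ker_eq_bot, Submodule.eq_bot_iff]
  intro z hz
  rw [LinearMap.mem_ker, ← smulMap_eq_zero_iff] at hz
  obtain ⟨w, rfl⟩ := hτ z
  rw [hcomp, smulMap_eq_zero_iff] at hz
  have hinj : Function.Injective (LinearMap.lTensor M I.subtype) :=
    Module.Flat.lTensor_preserves_injective_linearMap _ (Submodule.injective_subtype I)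
  rw [show w = 0 from hinj (by rw [hz, map_zero]), map_zero]

end TorTrick

/-! ### The kernel of `V → V ⊗_T k` for a field `k ⊇ T/𝔭` -/

section KernelTorsion

/-- For a domain `T₀` inside a field `k` and a `T₀`-module `V`, an element `v` with `v ⊗ 1 = 0`
in `V ⊗_{T₀} k` is killed by a nonzero element of `T₀`: `k` is free over `K = Frac T₀`, so
already `1 ⊗ v = 0` in `K ⊗_{T₀} V = (T₀ ∖ 0)⁻¹V`. [folklore] -/
theorem exists_smul_eq_zero_of_tmul_one_eq_zero_of_isDomain {T₀ : Type u} [CommRing T₀]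
    [IsDomain T₀] {k : Type v} [Field k] [Algebra T₀ k]
    (hinj : Function.Injective (algebraMap T₀ k)) {V : Type w} [AddCommGroup V] [Module T₀ V]
    (v : V) (hv : v ⊗ₜ[T₀] (1 : k) = 0) : ∃ t : T₀, t ≠ 0 ∧ t • v = 0 := by
  haveI : FaithfulSMul T₀ k := (faithfulSMul_iff_algebraMap_injective T₀ k).mpr hinj
  letI : Algebra (FractionRing T₀) k := FractionRing.liftAlgebra T₀ k
  let K := FractionRing T₀
  let f : V →ₗ[T₀] K ⊗[T₀] V := TensorProduct.mk T₀ K V 1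
  -- `1 ⊗ v = 0` in `k ⊗_{T₀} V`
  have hv' : (1 : k) ⊗ₜ[T₀] v = 0 := by
    have h := congrArg (TensorProduct.comm T₀ V k) hv
    rwa [TensorProduct.comm_tmul, map_zero] at h
  -- hence `1 ⊗ (1 ⊗ v) = 0` in `k ⊗_K (K ⊗_{T₀} V)`
  let e := TensorProduct.AlgebraTensorModule.cancelBaseChange T₀ K k k V
  have h1 : e ((1 : k) ⊗ₜ[K] f v) = (1 : k) ⊗ₜ[T₀] v := by
    simp [e, f, TensorProduct.AlgebraTensorModule.cancelBaseChange_tmul]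
  have h2 : (1 : k) ⊗ₜ[K] f v = 0 := e.injective (by rw [h1, hv', map_zero])
  -- `K ⊗ V → k ⊗_K (K ⊗ V)` is injective (`K → k` is an injective map of `K`-vector spaces)
  have h3 : f v = 0 := by
    have hK : Function.Injective (Algebra.linearMap K k) := (algebraMap K k).injective
    have h4 : Function.Injective (LinearMap.rTensor (K ⊗[T₀] V) (Algebra.linearMap K k)) :=
      Module.Flat.rTensor_preserves_injective_linearMap _ hK
    have h5 : LinearMap.rTensor (K ⊗[T₀] V) (Algebra.linearMap K k) ((1 : K) ⊗ₜ[K] f v) =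
        (1 : k) ⊗ₜ[K] f v := by
      rw [LinearMap.rTensor_tmul, Algebra.linearMap_apply, map_one]
    have h6 : (1 : K) ⊗ₜ[K] f v = 0 := h4 (by rw [h5, h2, map_zero])
    have h7 := congrArg (TensorProduct.lid K (K ⊗[T₀] V)) h6
    rwa [TensorProduct.lid_tmul, one_smul, map_zero] at h7
  obtain ⟨s, hs⟩ := (IsLocalizedModule.eq_zero_iff (nonZeroDivisors T₀) (f := f)).mp h3
  exact ⟨s, nonZeroDivisors.ne_zero s.2, hs⟩

/-- **The kernel of `V → V ⊗_T k` is `(T ∖ 𝔭)`-torsion**: for a prime `𝔭 ⊆ T`, a field `k`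
under `T` with `Ker(T → k) = 𝔭`, and a `T`-module `V` killed by `𝔭`, every `v` with `v ⊗ 1 = 0`
in `V ⊗_T k` is killed by some `t ∉ 𝔭` (pass to `T/𝔭 ⊆ k` and use
`exists_smul_eq_zero_of_tmul_one_eq_zero_of_isDomain`). [folklore] -/
theorem exists_smul_eq_zero_of_tmul_one_eq_zero {T : Type u} [CommRing T] (p : Ideal T)
    [p.IsPrime] {k : Type v} [Field k] [Algebra T k] (hk : ∀ t, algebraMap T k t = 0 ↔ t ∈ p)
    {V : Type w} [AddCommGroup V] [Module T V] (hV : ∀ t ∈ p, ∀ v : V, t • v = 0)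
    (v : V) (hv : v ⊗ₜ[T] (1 : k) = 0) : ∃ t : T, t ∉ p ∧ t • v = 0 := by
  -- `V` and `k` are modules over the domain `T/𝔭`
  have hT : Module.IsTorsionBySet T V p := fun v t => hV t t.2 v
  letI : Module (T ⧸ p) V := hT.module
  haveI : IsScalarTower T (T ⧸ p) V := hT.isScalarTower
  letI : Algebra (T ⧸ p) k :=
    (Ideal.Quotient.lift p (algebraMap T k) fun t ht => (hk t).mpr ht).toAlgebra
  haveI : IsScalarTower T (T ⧸ p) k :=
    IsScalarTower.of_algebraMap_eq fun t =>
      (Ideal.Quotient.lift_mk p (algebraMap T k) (fun t ht => (hk t).mpr ht)).symm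
  have hinj : Function.Injective (algebraMap (T ⧸ p) k) := by
    rw [injective_iff_map_eq_zero]
    intro t ht
    obtain ⟨t, rfl⟩ := Ideal.Quotient.mk_surjective t
    rw [Ideal.Quotient.eq_zero_iff_mem, ← hk]
    rwa [← Ideal.Quotient.algebraMap_eq, ← IsScalarTower.algebraMap_apply] at ht
  -- transport `v ⊗ 1 = 0` to the tensor product over `T/𝔭`
  haveI : SMulCommClass (T ⧸ p) T V :=
    ⟨fun a t v => by
      obtain ⟨a, rfl⟩ := Ideal.Quotient.mk_surjective a
      rw [← Ideal.Quotient.algebraMap_eq, algebraMap_smul, algebraMap_smul, smul_comm]⟩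
  have hv' : v ⊗ₜ[T ⧸ p] (1 : k) = 0 := by
    have h := congrArg (TensorProduct.mapOfCompatibleSMul (T ⧸ p) T T V k) hv
    rwa [TensorProduct.mapOfCompatibleSMul_tmul, map_zero] at h
  obtain ⟨t₀, ht₀, htv⟩ := exists_smul_eq_zero_of_tmul_one_eq_zero_of_isDomain hinj v hv'
  obtain ⟨t, rfl⟩ := Ideal.Quotient.mk_surjective t₀
  refine ⟨t, fun ht => ht₀ (Ideal.Quotient.eq_zero_iff_mem.mpr ht), ?_⟩
  rwa [← Ideal.Quotient.algebraMap_eq, algebraMap_smul] at htv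

end KernelTorsion

/-! ### `B/IB = B ⊗_A A/I` as a pushout square -/

section QuotientPushout

/-- **`B/IB = A/I ⊗_A B`**: the square `A → A/I`, `B → B/IB` is a pushout of rings (Mathlib's
`Algebra.TensorProduct.quotIdealMapEquivQuotTensor` in `Algebra.IsPushout` form). [folklore] -/
theorem isPushout_quotient_map (A : Type u) (B : Type v) [CommRing A] [CommRing B] [Algebra A B]
    (I : Ideal A) : Algebra.IsPushout A (A ⧸ I) B (B ⧸ I.map (algebraMap A B)) := by
  refine ⟨IsBaseChange.of_equiv
    (Algebra.TensorProduct.quotIdealMapEquivQuotTensor B I).symm.toLinearEquiv fun b => ?_⟩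
  rw [AlgEquiv.toLinearEquiv_apply, AlgEquiv.symm_apply_eq]
  exact (Algebra.TensorProduct.quotIdealMapEquivQuotTensor_mk B I b).symm

end QuotientPushout

/-! ### Going up: flatness at a prime after a base change of the source square -/

section GoingUp

/-- **Going up along a pushout square.** Let `C₀ → C` be a ring map, `P` a `C₀`-algebra and
`B′ = C ⊗_{C₀} P` (`Algebra.IsPushout C₀ C P B′`). Let `𝔮 ⊆ B′` be a prime and `Q = 𝔮 ∩ P`. If
`P_Q` is flat over `C₀`, then `B′_𝔮` is flat over `C`: `C ⊗_{C₀} P_Q ≅ B′ ⊗_P P_Q` is flat over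
`C` and is the localization of `B′` at the image of `P ∖ Q`, of which `B′_𝔮` is a further
localization ("`M = M_λ ⊗_{S_λ} S` is flat over `S` since the base change of a flat module is
flat", The Stacks Project, Tag 00R7, end of proof). [cite: StacksProject, Tag 00R7 (proof)] -/
theorem flat_localization_of_isPushout {C₀ : Type*} {C : Type*} {P : Type*} {B' : Type*}
    [CommRing C₀] [CommRing C] [CommRing P] [CommRing B'] [Algebra C₀ C] [Algebra C₀ P]
    [Algebra P B'] [Algebra C B'] [Algebra C₀ B'] [IsScalarTower C₀ C B'] [IsScalarTower C₀ P B']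
    [Algebra.IsPushout C₀ C P B'] (Q : Ideal P) [Q.IsPrime] (q : Ideal B') [q.IsPrime]
    (hQ : Q = q.comap (algebraMap P B')) [Module.Flat C₀ (Localization.AtPrime Q)] :
    Module.Flat C (Localization.AtPrime q) := by
  haveI : SMulCommClass P C B' :=
    ⟨fun y c b => by simp only [Algebra.smul_def]; ring⟩
  let N := Localization.AtPrime Q
  let L := B' ⊗[P] N
  let e : L ≃ₗ[C] C ⊗[C₀] N := Algebra.IsPushout.cancelBaseChange C₀ C P B' N
  haveI : Module.Flat C L := Module.Flat.of_linearEquiv e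
  -- `L` is the localization of `B′` at the image of `P ∖ Q`, and `B′_𝔮` a localization of `L`
  let S₁ : Submonoid B' := Algebra.algebraMapSubmonoid B' Q.primeCompl
  haveI : IsLocalization S₁ L := IsLocalization.tensor N Q.primeCompl
  have hle : S₁ ≤ q.primeCompl := by
    rintro _ ⟨y, hy, rfl⟩ h
    exact hy (show y ∈ Q from hQ ▸ h)
  letI : Algebra L (Localization.AtPrime q) :=
    IsLocalization.localizationAlgebraOfSubmonoidLe L (Localization.AtPrime q) S₁ q.primeCompl hle
  haveI : IsScalarTower B' L (Localization.AtPrime q) :=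
    IsLocalization.localization_isScalarTower_of_submonoid_le L (Localization.AtPrime q) S₁
      q.primeCompl hle
  haveI : IsLocalization (q.primeCompl.map (algebraMap B' L)) (Localization.AtPrime q) :=
    IsLocalization.isLocalization_of_submonoid_le L (Localization.AtPrime q) S₁ q.primeCompl hle
  haveI : Module.Flat L (Localization.AtPrime q) :=
    IsLocalization.flat (Localization.AtPrime q) (q.primeCompl.map (algebraMap B' L))
  haveI : IsScalarTower C L (Localization.AtPrime q) := by
    refine IsScalarTower.of_algebraMap_eq (R := C) (S := L) (A := Localization.AtPrime q)
      fun c => ?_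
    have h1 : algebraMap C L c = algebraMap B' L (algebraMap C B' c) :=
      IsScalarTower.algebraMap_apply C B' L c
    rw [h1, ← IsScalarTower.algebraMap_apply B' L (Localization.AtPrime q),
      ← IsScalarTower.algebraMap_apply C B' (Localization.AtPrime q)]
  exact Module.Flat.trans C L (Localization.AtPrime q)

end GoingUp

end Literature.RingTheory.Flat
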